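import Mathlib.Tactic.NormNum
import Mathlib.Tactic.Linarith
import HarnessLib

/-!
# Certified cell words from certified STATEMENTS: the «not»/«SC» conventions (C6/C7), their overlap, the registry's
# contradiction test (C5/W8) at statement level, and the «useless but right» class (C8)

Venture CertifiedManyBodySolver, cell `pub/hubbard-downfold`, seat hubbard-downfold-score-1 (second scoring engine);
namespace `Summit.Ventures.CertifiedManyBodySolver.Downfold.CellScore`. ACCEPTANCE §3.2: C6 (a certified «not» = a certified
order-parameter CEILING `≤ header.thresholds.not_below_order` — a CONVENTION the map states), C7 (a certified «SC» = a
certified order-parameter FLOOR `> 0`, annex kind `order-floor`; no such instrument exists in 2026-Q3), C5 (certified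
statements are append-only: a later map may TIGHTEN, never contradict; registry `certified-registry.jsonl`), §4.1 W8 (a word
contradicting a registered certified statement ⇒ map rejected), C8 («useless but right»: a certified bound weaker than the
physical range is VALID, class «certified, non-binding» = bound ≥ 2× the largest measured T_c of the class). Everything here
is PROVED (order reasoning on ℚ).

WHAT THIS IS NOT: not an order-parameter bound, not a registry, not a ruling. Both engines implement C5/C6/C8 as written and
no map of record carries a floor. This file is the KERNEL REFERENCE for the statement/word distinction those rules rest on,
and it records ONE GAP for the pen (finding F19, filed with this file): C6 and C7 are not mutually exclusive.

* §1 `Stmt` = `ceiling c` (m ≤ c) | `floor f` (f ≤ m) about one cell's order parameter `m`; `holdsFor m s`;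
  `licensesNot θ s` (C6), `licensesSC s` (C7); content theorems `le_of_licensesNot` (word «not» ⇒ m ≤ θ — and nothing
  more) and `pos_of_licensesSC` (word «SC» ⇒ 0 < m).
* §2 THE GAP `conventions_overlap`: with ANY declared threshold θ > 0 there are a ceiling and a floor, both true of the same
  m, one licensing «not», the other «SC» (θ = 1/10: ceiling 1/10, floor 1/20, m = 1/20). `overlap_iff`: for true statements
  f ≤ m ≤ c both words are licensed iff 0 < f ∧ c ≤ θ. So once a floor instrument exists the rules need a PRECEDENCE
  clause. Candidate (i) FLOOR WINS (`cellWord`: any positive floor ⇒ SC, else any ceiling ≤ θ ⇒ NOT, else UND) is sound: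
  `pos_of_cellWord_SC`, `le_of_cellWord_NOT`, and under it a NOT cell provably carries no positive floor
  (`no_floor_of_cellWord_NOT`).
* §3 C5/W8 AT STATEMENT LEVEL: `contradicts s t` (a ceiling below a floor); `contradicts_eq_false_of_common_model` (two
  statements true of one m never test as contradictory) ⇒ `exists_false_of_contradicts` (a detected contradiction proves one
  of the two certified statements FALSE whatever the truth — the SEV-1 reading); tightening a ceiling never contradicts and
  implies the registered one (`holdsFor_ceiling_mono`, `contradicts_ceiling_ceiling`); and `word_flip_consistent`: a registered
  «not» (ceiling 1/10 ≤ θ = 1/10) followed by a certified floor 1/20 FLIPS the cell word to «SC» under floor precedence with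
  NO contradiction (m = 1/20 satisfies both) — so the registry test must compare statements (`contradicts`), never words,
  or it would reject a consistent certified map once floors exist.
* §4 C8: `nonBinding bound tcMax` (2·tcMax ≤ bound); loosening preserves it; with the cuprate class maximum 133 K [float]
  (HgBa₂Ca₂Cu₃O₈₊δ, ambient) every certified T_c ceiling of record (1281.1, 1367, 1469, 1776.4, 2792.6, 2837.4 K, and the text's
  2937 K) is non-binding, and a cuprate ceiling binds iff it is below 266 K (`binding_iff_lt_266`).
-/

namespace Summit.Ventures.CertifiedManyBodySolver.Downfold

namespace CellScore

/-! ## §1 Statements, the two conventions, their content -/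

/-- A certified statement about ONE cell's order parameter `m`: a ceiling (`m ≤ c`, energy-window / exclusion certificates,
LADDER WORDING (i)) or a floor (`f ≤ m`, the «positive-order certificate» of knot №2 — none exists yet). [folklore] -/
inductive Stmt
  /-- `m ≤ c` -/
  | ceiling (c : ℚ)
  /-- `f ≤ m` -/
  | floor (f : ℚ)
  deriving DecidableEq, Repr

namespace Stmt

/-- The statement is true of the value `m`. [folklore] -/
def holdsFor (m : ℚ) : Stmt → Bool
  | ceiling c => decide (m ≤ c)
  | floor f => decide (f ≤ m)

/-- C6: the statement licenses the CONVENTIONAL word «not» at declared threshold θ (`not_below_order`): a ceiling ≤ θ.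
[folklore] -/
def licensesNot (θ : ℚ) : Stmt → Bool
  | ceiling c => decide (c ≤ θ)
  | floor _ => false

/-- C7: the statement licenses the word «SC»: a floor > 0. [folklore] -/
def licensesSC : Stmt → Bool
  | floor f => decide (0 < f)
  | ceiling _ => false

/-- CONTENT OF «not» (C6): a true statement licensing «not» gives `m ≤ θ` — and nothing more (in particular not `m = 0`;
«calling ≤ θ “not” is a convention the map must state»). [folklore] -/
theorem le_of_licensesNot (θ m : ℚ) (s : Stmt) (h : s.holdsFor m = true) (hn : s.licensesNot θ = true) : m ≤ θ := by
  cases s with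
  | ceiling c => simp [holdsFor] at h; simp [licensesNot] at hn; exact le_trans h hn
  | floor f => simp [licensesNot] at hn

/-- CONTENT OF «SC» (C7): a true statement licensing «SC» gives `0 < m`. [folklore] -/
theorem pos_of_licensesSC (m : ℚ) (s : Stmt) (h : s.holdsFor m = true) (hs : s.licensesSC = true) : 0 < m := by
  cases s with
  | ceiling c => simp [licensesSC] at hs
  | floor f => simp [holdsFor] at h; simp [licensesSC] at hs; exact lt_of_lt_of_le hs h

/-! ## §2 The gap: C6 and C7 overlap; a precedence clause and its soundness -/

/-- THE GAP (finding F19). For EVERY threshold θ > 0 there are two statements TRUE OF THE SAME order parameter, one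
licensing «not», the other «SC»: ceiling θ and floor θ/2 at m = θ/2. So C6 and C7 are not mutually exclusive; today this
is moot only because no floor instrument exists (C7). [folklore] -/
theorem conventions_overlap (θ : ℚ) (hθ : 0 < θ) :
    ∃ (s t : Stmt) (m : ℚ), s.holdsFor m = true ∧ t.holdsFor m = true ∧ s.licensesNot θ = true ∧ t.licensesSC = true := by
  refine ⟨ceiling θ, floor (θ / 2), θ / 2, ?_, ?_, ?_, ?_⟩
  · simp [holdsFor]; linarith
  · simp [holdsFor]
  · simp [licensesNot]
  · simp [licensesSC]; linarith

/-- The numeric instance reviewers can quote: θ = 1/10, ceiling 1/10 («not»), floor 1/20 («SC»), m = 1/20. [folklore] -/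
theorem conventions_overlap_tenth :
    (ceiling (1 / 10)).holdsFor (1 / 20) = true ∧ (floor (1 / 20)).holdsFor (1 / 20) = true ∧
      (ceiling (1 / 10)).licensesNot (1 / 10) = true ∧ (floor (1 / 20)).licensesSC = true := by
  refine ⟨?_, ?_, ?_, ?_⟩
  · norm_num [holdsFor]
  · norm_num [holdsFor]
  · norm_num [licensesNot]
  · norm_num [licensesSC]

/-- EXACTLY WHEN: for a TRUE floor/ceiling pair `f ≤ m ≤ c`, both words are licensed iff `0 < f ∧ c ≤ θ`. Hence the two
conventions exclude each other on every cell iff every certifiable floor exceeds θ — which no choice of θ > 0 can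
guarantee. [folklore] -/
theorem overlap_iff (θ f c : ℚ) :
    ((ceiling c).licensesNot θ = true ∧ (floor f).licensesSC = true) ↔ (0 < f ∧ c ≤ θ) := by
  simp [licensesNot, licensesSC, and_comm]

/-- Cell words. [folklore] -/
inductive CWord
  /-- superconducting -/
  | SC
  /-- «not» (by the C6 convention) -/
  | NOT
  /-- undetermined -/
  | UND
  deriving DecidableEq, Repr

/-- PRECEDENCE CANDIDATE (i) «FLOOR WINS» (substantive beats conventional): any statement licensing «SC» ⇒ SC; else any
licensing «not» ⇒ NOT; else UND. (Not a rule of record — offered with F19.) [folklore] -/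
def cellWord (θ : ℚ) (l : List Stmt) : CWord :=
  if l.any licensesSC then .SC else if l.any (licensesNot θ) then .NOT else .UND

/-- Soundness of SC under floor precedence: if every listed statement is true of m and the word is SC then 0 < m.
[folklore] -/
theorem pos_of_cellWord_SC (θ m : ℚ) (l : List Stmt) (hall : ∀ s ∈ l, s.holdsFor m = true)
    (hw : cellWord θ l = .SC) : 0 < m := by
  unfold cellWord at hw
  by_cases h : l.any licensesSC = true
  · obtain ⟨s, hs, hsc⟩ := List.any_eq_true.mp h
    exact pos_of_licensesSC m s (hall s hs) hsc
  · rw [Bool.not_eq_true] at h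
    by_cases h' : l.any (licensesNot θ) = true
    · simp [h, h'] at hw
    · rw [Bool.not_eq_true] at h'
      simp [h, h'] at hw

/-- Under floor precedence a NOT cell carries NO statement licensing «SC» (no positive floor). [folklore] -/
theorem no_floor_of_cellWord_NOT (θ : ℚ) (l : List Stmt) (hw : cellWord θ l = .NOT) :
    ∀ s ∈ l, s.licensesSC = false := by
  unfold cellWord at hw
  by_cases h : l.any licensesSC = true
  · simp [h] at hw
  · intro s hs
    rw [Bool.not_eq_true] at h
    have := List.any_eq_false.mp h s hs
    simpa using this

/-- Soundness of NOT under floor precedence: every listed statement true of m and word NOT ⇒ m ≤ θ. [folklore] -/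
theorem le_of_cellWord_NOT (θ m : ℚ) (l : List Stmt) (hall : ∀ s ∈ l, s.holdsFor m = true)
    (hw : cellWord θ l = .NOT) : m ≤ θ := by
  have hnf := no_floor_of_cellWord_NOT θ l hw
  unfold cellWord at hw
  by_cases h : l.any licensesSC = true
  · simp [h] at hw
  · simp only [h] at hw
    by_cases h' : l.any (licensesNot θ) = true
    · obtain ⟨s, hs, hn⟩ := List.any_eq_true.mp h'
      exact le_of_licensesNot θ m s (hall s hs) hn
    · simp [h'] at hw

/-- The word is UND iff nothing in the list licenses either word. [folklore] -/
theorem cellWord_eq_UND_iff (θ : ℚ) (l : List Stmt) :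
    cellWord θ l = .UND ↔ (l.any licensesSC = false ∧ l.any (licensesNot θ) = false) := by
  unfold cellWord
  by_cases h : l.any licensesSC = true <;> by_cases h' : l.any (licensesNot θ) = true <;> simp [h, h']

/-! ## §3 C5 / W8 at statement level: what a registry contradiction means -/

/-- Two statements CONTRADICT iff one is a ceiling strictly below the other's floor. Two ceilings (or two floors) never
contradict — the later one tightens or loosens. [folklore] -/
def contradicts : Stmt → Stmt → Bool
  | ceiling c, floor f => decide (c < f)
  | floor f, ceiling c => decide (c < f)
  | ceiling _, ceiling _ => false
  | floor _, floor _ => false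

/-- `contradicts` is symmetric. [folklore] -/
theorem contradicts_symm (s t : Stmt) : contradicts s t = contradicts t s := by
  cases s <;> cases t <;> simp [contradicts]

/-- Two statements true of ONE value never test as contradictory. [folklore] -/
theorem contradicts_eq_false_of_common_model (m : ℚ) (s t : Stmt) (hs : s.holdsFor m = true)
    (ht : t.holdsFor m = true) : contradicts s t = false := by
  cases s with
  | ceiling c =>
    cases t with
    | ceiling c' => simp [contradicts]
    | floor f => simp [holdsFor] at hs ht; simp [contradicts]; linarith
  | floor f =>
    cases t with
    | ceiling c => simp [holdsFor] at hs ht; simp [contradicts]; linarith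
    | floor f' => simp [contradicts]

/-- THE SEV-1 READING OF C5: a detected contradiction proves that, WHATEVER the true value, one of the two certified
statements is false — a kernel/certificate chain is broken somewhere, independent of truth files. [folklore] -/
theorem exists_false_of_contradicts (s t : Stmt) (h : contradicts s t = true) (m : ℚ) :
    s.holdsFor m = false ∨ t.holdsFor m = false := by
  by_cases hs : s.holdsFor m = true
  · by_cases ht : t.holdsFor m = true
    · have := contradicts_eq_false_of_common_model m s t hs ht
      rw [this] at h
      exact absurd h Bool.false_ne_true
    · exact Or.inr (by simpa using ht)
  · exact Or.inl (by simpa using hs)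

/-- TIGHTENING IS MONOTONE: a tighter ceiling `c' ≤ c` true of m implies the registered ceiling `c`. [folklore] -/
theorem holdsFor_ceiling_mono (m c c' : ℚ) (hle : c' ≤ c) (h : (ceiling c').holdsFor m = true) :
    (ceiling c).holdsFor m = true := by
  simp [holdsFor] at h ⊢; exact le_trans h hle

/-- … and two ceilings never register as a contradiction («a later map may TIGHTEN»). [folklore] -/
theorem contradicts_ceiling_ceiling (c c' : ℚ) : contradicts (ceiling c) (ceiling c') = false := by
  simp [contradicts]

/-- A floor ABOVE a registered ceiling is a contradiction (the only shape there is, up to symmetry). [folklore] -/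
theorem contradicts_ceiling_floor_iff (c f : ℚ) : contradicts (ceiling c) (floor f) = true ↔ c < f := by
  simp [contradicts]

/-- WORD FLIP WITHOUT CONTRADICTION (why W8/C5 must compare statements, not words): threshold θ = 1/10; the registry holds
ceiling 1/10 (cell word NOT); a later certified floor 1/20 arrives: under floor precedence the cell word becomes SC, yet the
two statements do not contradict (m = 1/20 satisfies both). A word-level registry test would reject this consistent
certified map; the statement-level test `contradicts` correctly passes it. [folklore] -/
theorem word_flip_consistent :
    cellWord (1 / 10) [ceiling (1 / 10)] = .NOT ∧ cellWord (1 / 10) [ceiling (1 / 10), floor (1 / 20)] = .SC ∧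
      contradicts (ceiling (1 / 10)) (floor (1 / 20)) = false ∧
      ((ceiling (1 / 10)).holdsFor (1 / 20) = true ∧ (floor (1 / 20)).holdsFor (1 / 20) = true) := by
  refine ⟨?_, ?_, ?_, ?_, ?_⟩
  · simp [cellWord, licensesSC, licensesNot]
  · simp [cellWord, licensesSC]
  · simp [contradicts]; norm_num
  · simp [holdsFor]; norm_num
  · simp [holdsFor]

/-- Whereas a floor ABOVE the registered ceiling IS a contradiction: ceiling 1/10 vs floor 1/5. [folklore] -/
theorem genuine_contradiction : contradicts (ceiling (1 / 10)) (floor (1 / 5)) = true := by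
  simp [contradicts]; norm_num

/-! ## §4 C8 «useless but right»: the non-binding class -/

/-- C8: a certified T_c ceiling `bound` (kelvin) is NON-BINDING for a material class whose largest measured T_c is `tcMax`
iff `2·tcMax ≤ bound`. It stays VALID and is reported, never suppressed. [folklore] -/
def nonBinding (bound tcMax : ℚ) : Bool := decide (2 * tcMax ≤ bound)

/-- Loosening a non-binding bound keeps it non-binding (the class is upward closed in the bound). [folklore] -/
theorem nonBinding_of_le (b b' tcMax : ℚ) (hle : b ≤ b') (h : nonBinding b tcMax = true) : nonBinding b' tcMax = true := by
  simp [nonBinding] at h ⊢; exact le_trans h hle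

/-- A bound leaves the class (becomes BINDING) iff it is below twice the class maximum. [folklore] -/
theorem nonBinding_eq_false_iff (b tcMax : ℚ) : nonBinding b tcMax = false ↔ b < 2 * tcMax := by
  simp [nonBinding]

/-- Numbers of record, cuprate class maximum 133 K [float] (HgBa₂Ca₂Cu₃O₈₊δ at ambient pressure): every certified T_c
ceiling in the maps of record — M50 1281.1 K, LSCO 1367 / 1469 / 1776.4 K, Hg1201 2792.6 / 2837.4 K — and the text's example
2937 K are NON-BINDING (C8: valid, right currency, no information yet). [folklore] -/
theorem ceilings_of_record_nonBinding :
    nonBinding (12811 / 10) 133 = true ∧ nonBinding 1367 133 = true ∧ nonBinding 1469 133 = true ∧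
      nonBinding (17764 / 10) 133 = true ∧ nonBinding (27926 / 10) 133 = true ∧ nonBinding (28374 / 10) 133 = true ∧
      nonBinding 2937 133 = true := by
  refine ⟨?_, ?_, ?_, ?_, ?_, ?_, ?_⟩ <;> simp [nonBinding] <;> norm_num

/-- … and a cuprate ceiling would BIND iff it came in below 266 K. [folklore] -/
theorem binding_iff_lt_266 (b : ℚ) : nonBinding b 133 = false ↔ b < 266 := by
  rw [nonBinding_eq_false_iff]; norm_num

end Stmt

end CellScore

end Summit.Ventures.CertifiedManyBodySolver.Downfold
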